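import Mathlib
import HarnessLib
import Summits.FinalStateConjecture.Statement
import Literature.Geometry.Lorentzian.Stationary
import Literature.Geometry.Lorentzian.KerrData
import Literature.Geometry.Lorentzian.Isometry
import Literature.Geometry.Lorentzian.Einstein
import Literature.Geometry.Lorentzian.Geodesic
import Literature.Geometry.Lorentzian.Causality
import Literature.Geometry.Lorentzian.IPlusRegular
import Literature.Geometry.Lorentzian.TameBreathingCurve

/-!
# Sketch (ideator 2, crux stmt-FinalStateConjecture-17839 `FinalStateFromKerrOrBomb`) — GR side

Part II (card `sweep-or-lock`): IMMERSION IS FREE — the statement, over tree declarations, that a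
tame family of admissible data whose members off `0` have an isometry-invariant property `P`, and
which leaves a far coordinate ball untouched, upgrades to a tame, IMMERSED, injective witness by
composing with the breathing diffeomorphisms (`AFEnd.breatheFamily`, `TameBreathingCurve.lean`).
Stated with `sorry` (first lemma of the line; every constant exists).

Part III (card `dock-on-the-cohypotheses`): the DOCKING typechecks with zero transport — verbatim
copies of the route decls `NonTrappingHawkingRigidity` (stmt-13896) and `HawkingExtensionIsKerr`
(stmt-17840) (rev 9 bodies; the farm module of the route lags, so the bodies are inlined as the
refuter did in Wlocal.lean) and the PROVED contrapositive `trappedRay_of_not_kerr`: in the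
byte-identical telescope, a hole whose d.o.c. is NOT a sub-extremal Kerr exterior carries a maximal
zero-energy null geodesic trapped modulo the stationary flow.
-/

set_option linter.dupNamespace false
set_option maxHeartbeats 800000

open scoped Manifold ContDiff Topology
open Filter Set Function

namespace Summit.FinalStateConjecture.FinalStateConjecture.Cruxes.FinalStateFromKerrOrBomb.Ideator2

open Literature.Geometry.Lorentzian

/-! ## Part II — immersion is free (breathing upgrade) -/

/-- **Immersion is free.** Let `G` be a tame one-parameter family of admissible data on the end `e`
(NOT assumed immersed, NOT assumed injective — e.g. flat at `0`), whose members off `0` satisfy a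
property `P` invariant under the breathing pull-backs, and which agrees with `G 0` on the breathing
region `coord⁻¹(closedBall z₀ 2r)` of some breathing datum `B` far out on `e` (the physical
modification — compact kick, far-field surgery beyond it — lives elsewhere). Then `c ↦ (breathe (σ c₀))^* (G c)` is a tame
(on a collar of `e`), IMMERSED, injective admissible curve through `G 0` whose members off `0`
satisfy `P`. (Marker: `h(x₀)(v₀,v₀)` scales by `(1 + σ c₀)²` at the breathing centre, where
`G c = G 0`; cf. `AFEnd.isImmersedAtZero_breatheCurve`, `AFEnd.injective_breatheCurve`.) -/
theorem immersion_is_free {X : Type} [TopologicalSpace X] [ChartedSpace E3 X]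
    [IsManifold (𝓡 3) ∞ X] [T2Space X] [SecondCountableTopology X] [ConnectedSpace X]
    (P : InitialDataSet (𝓡 3) X → Prop) (e : AFEnd X) {z₀ : E3} {r : ℝ}
    (B : AFEnd.BreathingData e z₀ r)
    (hP : ∀ (d : InitialDataSet (𝓡 3) X) (t : ℝ), P (AFEnd.breatheFamily B d t) ↔ P d)
    (G : EuclideanSpace ℝ (Fin 1) → InitialDataSet (𝓡 3) X)
    (hG : InitialDataSet.IsTameDataFamily e 1 G) (hadm : ∀ c, G c ∈ admissibleVacuumData X)
    (hgood : ∀ c ≠ 0, P (G c))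
    (hfar : ∀ c, ∀ x ∈ e.U, e.coord x ∈ Metric.closedBall z₀ (2 * r) →
      (G c).h.inner x = (G 0).h.inner x ∧ (G c).k x = (G 0).k x) :
    ∃ (R₁ : ℝ) (hR₁ : e.R ≤ R₁) (F : EuclideanSpace ℝ (Fin 1) → InitialDataSet (𝓡 3) X),
      InitialDataSet.IsTameDataFamily (e.restrict hR₁) 1 F ∧ InitialDataSet.IsImmersedAtZero 1 F ∧
        Function.Injective F ∧ F 0 = G 0 ∧ (∀ c, F c ∈ admissibleVacuumData X) ∧ ∀ c ≠ 0, P (F c) := by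
  sorry

/-! ## Part III — docking on the co-hypotheses of `closes` -/

/-- VERBATIM `Theses.ZeroEnergyKerrOrBomb.NonTrappingHawkingRigidity` (stmt-13896, rev 9 body). -/
def NTHR' : Prop :=
  ∀ (𝓑 : Literature.Geometry.Lorentzian.StationaryAFBlackHole.{0}) [𝓑.metric.HasLeviCivita], 𝓑.metric.toPseudoRiemannianMetric.IsRicciFlat → 𝓑.IsIPlusRegular → (∀ p : 𝓑.carrier, p ∈ 𝓑.metric.chronologicalFuture 𝓑.timeOrientation 𝓑.Mext) → (∀ p ∈ 𝓑.doc, 𝓑.killing p ≠ 0) → SimplyConnectedSpace 𝓑.doc → ∀ (U : Set 𝓑.carrier) (K : Π x : 𝓑.carrier, TangentSpace (𝓡 4) x), IsOpen U → 𝓑.horizon ⊆ U → IsConnected 𝓑.horizon → ContMDiffOn (𝓡 4) ((𝓡 4).prod 𝓘(ℝ, Literature.Geometry.Lorentzian.E4)) ((⊤ : ℕ∞) : WithTop ℕ∞) (fun x ↦ (Bundle.TotalSpace.mk' Literature.Geometry.Lorentzian.E4 x (K x) : TangentBundle (𝓡 4) 𝓑.carrier)) U → (∀ x ∈ U, ∀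 v w : TangentSpace (𝓡 4) x, 𝓑.metric.val x (𝓑.metric.leviCivita K x v) w + 𝓑.metric.val x v (𝓑.metric.leviCivita K x w) = 0) → (∀ x ∈ U, VectorField.mlieBracket (𝓡 4) 𝓑.killing K x = 0) → (∀ p ∈ 𝓑.horizon, K p ≠ 0) → (∀ γ : ℝ → 𝓑.carrier, IsMIntegralCurve γ K → γ 0 ∈ 𝓑.horizon → ∀ t, γ t ∈ 𝓑.horizon) → (∀ x ∈ U ∩ 𝓑.doc, 𝓑.metric.val x (K x) (K x) < 0) → (∃ S₀ : Set 𝓑.carrier, IsCompact S₀ ∧ S₀ ⊆ 𝓑.doc ∧ ∀ y ∈ 𝓑.doc, 0 ≤ 𝓑.metric.val y (𝓑.killing y) (𝓑.killing y) → y ∉ U → y ∈ Literature.Geometry.Lorentzian.stationaryOrbit 𝓑.killing S₀) → (∀ S : Set 𝓑.carrier, IsCompact S → S ⊆ 𝓑.doc → ∀ (γ : ℝ → 𝓑.carrier) (s : Set ℝ), Literature.Geometry.Lorentzian.IsMaximalGeodesicOn 𝓑.metric.toPseudoRiemannianMetric.leviCivita γ s → s.Nonempty → (∀ t ∈ s,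 𝓑.metric.val (γ t) (Literature.Geometry.Lorentzian.velocity (𝓡 4) γ t) (Literature.Geometry.Lorentzian.velocity (𝓡 4) γ t) = 0 ∧ Literature.Geometry.Lorentzian.velocity (𝓡 4) γ t ≠ 0 ∧ 𝓑.metric.val (γ t) (Literature.Geometry.Lorentzian.velocity (𝓡 4) γ t) (𝓑.killing (γ t)) = 0) → ∃ t ∈ s, γ t ∉ Literature.Geometry.Lorentzian.stationaryOrbit 𝓑.killing S) → ∃ K' : Π x : 𝓑.carrier, TangentSpace (𝓡 4) x, ContMDiffOn (𝓡 4) ((𝓡 4).prod 𝓘(ℝ, Literature.Geometry.Lorentzian.E4)) ((⊤ : ℕ∞) : WithTop ℕ∞) (fun x ↦ (Bundle.TotalSpace.mk' Literature.Geometry.Lorentzian.E4 x (K' x) : TangentBundle (𝓡 4) 𝓑.carrier)) 𝓑.doc ∧ (∀ x ∈ 𝓑.doc, ∀ v w : TangentSpace (𝓡 4) x, 𝓑.metric.val x (𝓑.metric.leviCivita K' x v) w + 𝓑.metric.val x v (𝓑.metric.leviCivita K' x w) = 0) ∧ (∀ x ∈ 𝓑.doc, VectorField.mlieBracket (𝓡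 4) 𝓑.killing K' x = 0) ∧ ∃ U' : Set 𝓑.carrier, IsOpen U' ∧ 𝓑.horizon ⊆ U' ∧ ∀ x ∈ U' ∩ 𝓑.doc, K' x = K x

/-- VERBATIM `Theses.ZeroEnergyKerrOrBomb.HawkingExtensionIsKerr` (stmt-17840, rev 9 body). -/
def HEIK' : Prop :=
  ∀ (𝓑 : Literature.Geometry.Lorentzian.StationaryAFBlackHole.{0}) [𝓑.metric.HasLeviCivita] [Literature.Geometry.Lorentzian.Kerr.Facts], 𝓑.metric.toPseudoRiemannianMetric.IsRicciFlat → 𝓑.IsIPlusRegular → (∀ p : 𝓑.carrier, p ∈ 𝓑.metric.chronologicalFuture 𝓑.timeOrientation 𝓑.Mext) → (∀ p ∈ 𝓑.doc, 𝓑.killing p ≠ 0) → SimplyConnectedSpace 𝓑.doc → ∀ (U : Set 𝓑.carrier) (K : Π x : 𝓑.carrier, TangentSpace (𝓡 4) x), IsOpen U → 𝓑.horizon ⊆ U → IsConnected 𝓑.horizon → ContMDiffOn (𝓡 4) ((𝓡 4).prod 𝓘(ℝ, Literature.Geometry.Lorentzian.E4)) ((⊤ : ℕ∞) : WithTop ℕ∞)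 (fun x ↦ (Bundle.TotalSpace.mk' Literature.Geometry.Lorentzian.E4 x (K x) : TangentBundle (𝓡 4) 𝓑.carrier)) U → (∀ x ∈ U, ∀ v w : TangentSpace (𝓡 4) x, 𝓑.metric.val x (𝓑.metric.leviCivita K x v) w + 𝓑.metric.val x v (𝓑.metric.leviCivita K x w) = 0) → (∀ x ∈ U, VectorField.mlieBracket (𝓡 4) 𝓑.killing K x = 0) → (∀ p ∈ 𝓑.horizon, K p ≠ 0) → (∀ γ : ℝ → 𝓑.carrier, IsMIntegralCurve γ K → γ 0 ∈ 𝓑.horizon → ∀ t, γ t ∈ 𝓑.horizon) → (∀ x ∈ U ∩ 𝓑.doc, 𝓑.metric.val x (K x) (K x) < 0) → (∃ K' : Π x : 𝓑.carrier, TangentSpace (𝓡 4) x, ContMDiffOn (𝓡 4) ((𝓡 4).prod 𝓘(ℝ, Literature.Geometry.Lorentzian.E4)) ((⊤ : ℕ∞) : WithTop ℕ∞) (fun x ↦ (Bundle.TotalSpace.mk' Literature.Geometry.Lorentzian.E4 x (K' x) : TangentBundle (𝓡 4) 𝓑.carrier)) 𝓑.doc ∧ (∀ x ∈ 𝓑.doc,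 ∀ v w : TangentSpace (𝓡 4) x, 𝓑.metric.val x (𝓑.metric.leviCivita K' x v) w + 𝓑.metric.val x v (𝓑.metric.leviCivita K' x w) = 0) ∧ (∀ x ∈ 𝓑.doc, VectorField.mlieBracket (𝓡 4) 𝓑.killing K' x = 0) ∧ ∃ U' : Set 𝓑.carrier, IsOpen U' ∧ 𝓑.horizon ⊆ U' ∧ ∀ x ∈ U' ∩ 𝓑.doc, K' x = K x) → ∃ (M a : ℝ), Literature.Geometry.Lorentzian.Kerr.IsSubextremal M a ∧ ∃ Ψ : Literature.Geometry.Lorentzian.Kerr.exterior M a → 𝓑.carrier, Function.Injective Ψ ∧ Set.range Ψ = 𝓑.doc ∧ Literature.Geometry.Lorentzian.PseudoRiemannianMetric.IsIsometricImmersion (Literature.Geometry.Lorentzian.Kerr.smoothMetric M a (Literature.Geometry.Lorentzian.Kerr.rPlus M a)).toPseudoRiemannianMetric 𝓑.metric.toPseudoRiemannianMetric Ψ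

/-- **Docking lemma (PROVED).** Given the two rigidity co-hypotheses of `closes` — taken BY NAME,
as the r7 skeleton takes `MGHDExists` — every hole of the byte-identical telescope whose d.o.c. is
not a sub-extremal Kerr exterior carries a maximal zero-energy null geodesic (`g(γ̇,γ̇) = 0`,
`γ̇ ≠ 0`, `g(γ̇,T) = 0`) staying inside the `T`-orbit of a compact subset of the d.o.c.: the optical,
spin-blind handle on a realised bomb. `[Kerr.Facts]` is the instance binder of `HEIK'`. -/
theorem trappedRay_of_not_kerr (hN : NTHR') (hD : HEIK') :
    ∀ (𝓑 : Literature.Geometry.Lorentzian.StationaryAFBlackHole.{0}) [𝓑.metric.HasLeviCivita]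
      [Literature.Geometry.Lorentzian.Kerr.Facts],
      𝓑.metric.toPseudoRiemannianMetric.IsRicciFlat → 𝓑.IsIPlusRegular →
      (∀ p : 𝓑.carrier, p ∈ 𝓑.metric.chronologicalFuture 𝓑.timeOrientation 𝓑.Mext) →
      (∀ p ∈ 𝓑.doc, 𝓑.killing p ≠ 0) → SimplyConnectedSpace 𝓑.doc →
      ∀ (U : Set 𝓑.carrier) (K : Π x : 𝓑.carrier, TangentSpace (𝓡 4) x), IsOpen U → 𝓑.horizon ⊆ U →
      IsConnected 𝓑.horizon →
      ContMDiffOn (𝓡 4) ((𝓡 4).prod 𝓘(ℝ, Literature.Geometry.Lorentzian.E4)) ((⊤ : ℕ∞) : WithTop ℕ∞)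
        (fun x ↦ (Bundle.TotalSpace.mk' Literature.Geometry.Lorentzian.E4 x (K x) : TangentBundle (𝓡 4) 𝓑.carrier)) U →
      (∀ x ∈ U, ∀ v w : TangentSpace (𝓡 4) x, 𝓑.metric.val x (𝓑.metric.leviCivita K x v) w +
        𝓑.metric.val x v (𝓑.metric.leviCivita K x w) = 0) →
      (∀ x ∈ U, VectorField.mlieBracket (𝓡 4) 𝓑.killing K x = 0) → (∀ p ∈ 𝓑.horizon, K p ≠ 0) →
      (∀ γ : ℝ → 𝓑.carrier, IsMIntegralCurve γ K → γ 0 ∈ 𝓑.horizon → ∀ t, γ t ∈ 𝓑.horizon) →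
      (∀ x ∈ U ∩ 𝓑.doc, 𝓑.metric.val x (K x) (K x) < 0) →
      (∃ S₀ : Set 𝓑.carrier, IsCompact S₀ ∧ S₀ ⊆ 𝓑.doc ∧ ∀ y ∈ 𝓑.doc,
        0 ≤ 𝓑.metric.val y (𝓑.killing y) (𝓑.killing y) → y ∉ U →
          y ∈ Literature.Geometry.Lorentzian.stationaryOrbit 𝓑.killing S₀) →
      (¬ ∃ (M a : ℝ), Literature.Geometry.Lorentzian.Kerr.IsSubextremal M a ∧
          ∃ Ψ : Literature.Geometry.Lorentzian.Kerr.exterior M a → 𝓑.carrier, Function.Injective Ψ ∧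
            Set.range Ψ = 𝓑.doc ∧
            Literature.Geometry.Lorentzian.PseudoRiemannianMetric.IsIsometricImmersion
              (Literature.Geometry.Lorentzian.Kerr.smoothMetric M a
                (Literature.Geometry.Lorentzian.Kerr.rPlus M a)).toPseudoRiemannianMetric
              𝓑.metric.toPseudoRiemannianMetric Ψ) →
      ∃ S : Set 𝓑.carrier, IsCompact S ∧ S ⊆ 𝓑.doc ∧ ∃ (γ : ℝ → 𝓑.carrier) (s : Set ℝ),
        Literature.Geometry.Lorentzian.IsMaximalGeodesicOn 𝓑.metric.toPseudoRiemannianMetric.leviCivita γ s ∧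
        s.Nonempty ∧
        (∀ t ∈ s, 𝓑.metric.val (γ t) (Literature.Geometry.Lorentzian.velocity (𝓡 4) γ t)
            (Literature.Geometry.Lorentzian.velocity (𝓡 4) γ t) = 0 ∧
          Literature.Geometry.Lorentzian.velocity (𝓡 4) γ t ≠ 0 ∧
          𝓑.metric.val (γ t) (Literature.Geometry.Lorentzian.velocity (𝓡 4) γ t) (𝓑.killing (γ t)) = 0) ∧
        ∀ t ∈ s, γ t ∈ Literature.Geometry.Lorentzian.stationaryOrbit 𝓑.killing S := by
  intro 𝓑 _ _ hRic hreg hfut hT hsc U K hUo hHU hconn hKs hKill hcomm hne htan hcollar hbelt hnotKerr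
  by_contra hcon
  push Not at hcon
  apply hnotKerr
  refine hD 𝓑 hRic hreg hfut hT hsc U K hUo hHU hconn hKs hKill hcomm hne htan hcollar ?_
  refine hN 𝓑 hRic hreg hfut hT hsc U K hUo hHU hconn hKs hKill hcomm hne htan hcollar hbelt ?_
  intro S hS hSd γ s hγ hs hnull
  exact hcon S hS hSd γ s hγ hs hnull

end Summit.FinalStateConjecture.FinalStateConjecture.Cruxes.FinalStateFromKerrOrBomb.Ideator2
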